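import Summits.NavierStokesRegularity.NavierStokesRegularity.Theses.TypeIQuarterGate
import Summits.NavierStokesRegularity.NavierStokesRegularity.Theorems.TypeIQuarterGateEnvelopeQuarterLawTools
import Summits.NavierStokesRegularity.NavierStokesRegularity.Theorems.SoloSalvageLucardoOlivaes2026Enstrophy
import Summits.NavierStokesRegularity.NavierStokesRegularity.Theorems.TypeILiouvilleTypeIliouvilleNoTypeIIStubGradientSharpOfTypeI
import Literature.Analysis.FluidPDE.BKMClassEnstrophyContinuity
import HarnessLib

/-!
# `TypeIQuarterGate.EnvelopeQuarterLaw` (item stmt-NavierStokesRegularity-23844): the scar envelope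
# forces Leray's quarter rate on the enstrophy

**Statement (the route decl, verbatim).** For `ν, T > 0` and a maximal smooth solution `(u, p)` of the
unforced Navier–Stokes system on `ℝ³ × [0,T)`, Leray–Hopf from its rapidly decaying datum, the scar
envelope `‖u(t,x)‖ ≤ C' + Σ_{a ∈ σ} C'/(‖x − a‖ + √(T−t))` (`σ` finite) on `[0,T)` implies
`∫ ‖curl u(t)‖² ≤ K/√(T−t)` on `[0,T)` for some `K`.

PROOF (a GLOBAL enstrophy argument; no local regularity theory is needed).
1. The envelope gives the sup-norm Type-I rate `‖u(t)‖_∞ ≤ C'(√T + N)/√(T−t)` (`N = #σ`), hence by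
   KNSS smoothing at the Type-I scale (tree: `GradientPivot.stub_gradientSharp_of_typeI`) the gradient
   rate `‖∇u(t)‖_∞ ≤ C_g/(T−t)` near `T`, so `‖curl u(t)‖_∞ ≤ √6 C_g/(T−t)`.
2. The enstrophy identity `Z' = 2S − 2νP` along the solution (tree: `LucardoOlivaes2026.hasDerivAt_half_ensq`
   on the Chae/BKM class supplied by `RungReynoldsOne.stub_taoCover`), with the
   stretching integral in Lamb form `S = ∫⟪u, ω × curl ω⟫` (tree:
   `DepletionLadder.integral_stretching_eq_integral_inner_cross`).
3. SLICE ESTIMATE. Split `ℝ³` into the cores `⋃_{a∈σ} B(a, λ√(T−t))` and their complement. Off the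
   cores the envelope gives `‖u‖ ≤ m = C'(1 + N/((λ+1)√(T−t)))`; on the cores `‖u‖ ≤ C'(1 + N/√(T−t))`,
   `‖ω‖ ≤ √6 C_g/(T−t)` and the volume is `N·|B₁|·λ³(T−t)^{3/2}`. Cauchy–Schwarz:
   `|S| ≤ (m √Z + C'(1+N/√(T−t)) √6 C_g/(T−t) √(N|B₁|λ³(T−t)^{3/2})) · ‖curl ω‖₂`, `‖curl ω‖₂² ≤ 2P`.
4. Young: `Z' ≤ (4C'²/ν) Z + (4C'²N²/(ν(λ+1)²)) Z/(T−t) + K/(T−t)^{3/2}`; the choice `λ = 4C'N/√ν`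
   makes the singular coefficient `≤ 1/4 < 1/2`.
5. Gronwall with the weight `e^{−a t}(T−t)^{1/4}`: `Z(t) ≤ K'/√(T−t)` near `T`; on the initial
   compact interval the Sobolev norms are bounded (tree: `RungReynoldsOne.stub_taoCover`).

HONEST FRAMING: bookkeeping along a HYPOTHETICAL blow-up solution with a hypothetical envelope; nothing
here asserts that such a solution exists and nothing about Navier–Stokes regularity or blow-up is
claimed. The cruxes `FiniteScarsTypeI` / `ScarEnvelopeTypeI` of the route are NOT touched.

References: Koch–Nadirashvili–Seregin–Šverák 2009 §4 (4.6); Leray 1934 §20; Majda–Bertozzi 2002 §3.1.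
[folklore]
-/

-- the problem directory repeats the summit name (`NavierStokesRegularity/NavierStokesRegularity`)
set_option linter.dupNamespace false

noncomputable section

open Set Filter MeasureTheory Topology Metric
open scoped RealInnerProductSpace ENNReal NNReal ContDiff

namespace Summit.NavierStokesRegularity.NavierStokesRegularity.Theorems

namespace EnvelopeQuarterLaw

open Literature.Analysis.FluidPDE

/-! ### Steps 1, 2 and the assembly -/

/-- **The envelope forces the quarter law** (the item's content): under the scar envelope a maximal
smooth Leray–Hopf rapidly-decaying-datum solution has `∫ ‖curl u(t)‖² ≤ K/√(T−t)` on `[0,T)`.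
[cite: KochNadirashviliSereginSverak2009, §4 Prop. 4.1 (4.6) (arXiv:0709.3599v1 p. 8)] -/
theorem main (ν T : ℝ) (hν : 0 < ν) (hT : 0 < T)
    (u : ℝ → EuclideanSpace ℝ (Fin 3) → EuclideanSpace ℝ (Fin 3))
    (p : ℝ → EuclideanSpace ℝ (Fin 3) → ℝ)
    (hmax : IsMaximalSmoothSolution ν 0 u p T) (hLH : IsLerayHopfOn T ν 0 (u 0) u)
    (hdec : HasRapidSpatialDecay (u 0))
    (henv : ∃ (σ : Finset (EuclideanSpace ℝ (Fin 3))) (C' : ℝ), ∀ t ∈ Ico 0 T, ∀ x,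
      ‖u t x‖ ≤ C' + ∑ a ∈ σ, C' / (‖x - a‖ + Real.sqrt (T - t))) :
    ∃ K : ℝ, ∀ t ∈ Ico 0 T,
      ∫⁻ x, ‖curl (u t) x‖ₑ ^ 2 ≤ ENNReal.ofReal (K / Real.sqrt (T - t)) := by
  obtain ⟨σ, C', henv⟩ := henv
  obtain ⟨N, hN_def⟩ : ∃ N : ℝ, N = (σ.card : ℝ) := ⟨_, rfl⟩
  have hN0 : 0 ≤ N := by rw [hN_def]; exact Nat.cast_nonneg _
  have hsol : IsClassicalNSSolutionOn (Ico 0 T) ν 0 u p := hmax.1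
  -- `C' ≥ 0` (test the envelope at `t = 0`, `x = 0`)
  have hC' : 0 ≤ C' := by
    by_contra hneg
    push Not at hneg
    have h := henv 0 ⟨le_rfl, hT⟩ 0
    have hsum : ∑ a ∈ σ, C' / (‖(0 : EuclideanSpace ℝ (Fin 3)) - a‖ + Real.sqrt (T - 0)) ≤ 0 :=
      Finset.sum_nonpos fun a _ => (div_neg_of_neg_of_pos hneg (by positivity)).le
    linarith [norm_nonneg (u 0 0)]
  -- the Chae/BKM class of the solution (Tao 2013 Cor. 11.1 via the tree's sub-slab cover)
  have hLS : Literature.Claims.NS.Chae2007.IsLocalSolution ν T (u 0) u p :=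
    { isClassical := hsol
      initial := rfl
      sobolev := by
        intro T'' hT''
        have hT' : max T'' (T / 2) ∈ Ioo 0 T :=
          ⟨lt_max_of_lt_right (half_pos hT), max_lt hT'' (half_lt_self hT)⟩
        obtain ⟨q, -, hB, -, -⟩ := RungReynoldsOne.stub_taoCover hν hT hsol hLH hdec hT'
        exact hB.mono (Icc_subset_Icc_right (le_max_left _ _)) }
  -- Step 1a: the sup-norm Type-I rate from the envelope
  have hsT : ∀ t ∈ Ico 0 T, 0 < Real.sqrt (T - t) ∧ Real.sqrt (T - t) ≤ Real.sqrt T := fun t ht =>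
    ⟨Real.sqrt_pos.2 (by linarith [ht.2]), Real.sqrt_le_sqrt (by linarith [ht.1])⟩
  have hsup : ∀ t ∈ Ico 0 T, ∀ x, ‖u t x‖ ≤ C' * (1 + N / Real.sqrt (T - t)) := by
    intro t ht x
    obtain ⟨hs, -⟩ := hsT t ht
    refine (henv t ht x).trans ?_
    have h := Finset.sum_le_card_nsmul σ (fun a => C' / (‖x - a‖ + Real.sqrt (T - t)))
      (C' / Real.sqrt (T - t))
      (fun a _ => div_le_div_of_nonneg_left hC' hs (le_add_of_nonneg_left (norm_nonneg _)))
    rw [nsmul_eq_mul] at h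
    have : C' + ↑σ.card * (C' / Real.sqrt (T - t)) = C' * (1 + N / Real.sqrt (T - t)) := by
      rw [hN_def]; ring
    linarith
  have hI : IsTypeIBlowup u T := by
    refine ⟨C' * (Real.sqrt T + N), ?_⟩
    filter_upwards [Ioo_mem_nhdsLT hT] with t ht x
    obtain ⟨hs, hsT'⟩ := hsT t ⟨ht.1.le, ht.2⟩
    refine (hsup t ⟨ht.1.le, ht.2⟩ x).trans ?_
    rw [le_div_iff₀ hs]
    have : C' * (1 + N / Real.sqrt (T - t)) * Real.sqrt (T - t) = C' * (Real.sqrt (T - t) + N) := by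
      field_simp
    rw [this]
    exact mul_le_mul_of_nonneg_left (by linarith) hC'
  -- Step 1b: the gradient rate near `T` (KNSS smoothing at the Type-I scale, tree)
  obtain ⟨Cg, hCg⟩ :=
    TypeIliouvilleNoTypeII.GradientPivot.stub_gradientSharp_of_typeI ν T hν hT u p hsol hLH hdec hI
  obtain ⟨tg, htgT, hgsub⟩ := mem_nhdsLT_iff_exists_Ioo_subset.1 hCg
  obtain ⟨t₁, ht₁_def⟩ : ∃ t₁ : ℝ, t₁ = max tg 0 := ⟨_, rfl⟩
  have ht₁T : t₁ < T := by rw [ht₁_def]; exact max_lt htgT hT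
  have ht₁0 : 0 ≤ t₁ := by rw [ht₁_def]; exact le_max_right _ _
  have hgrad : ∀ t ∈ Ioo t₁ T, ∀ x, ‖fderiv ℝ (u t) x‖ ≤ Cg / (T - t) := fun t ht =>
    hgsub ⟨lt_of_le_of_lt (ht₁_def ▸ le_max_left _ _) ht.1, ht.2⟩
  -- Step 2: the enstrophy budget along the solution (tree: the classical enstrophy identity)
  obtain ⟨Zr, hZr_def⟩ : ∃ Zr : ℝ → ℝ, Zr = fun t => ∫ x, ‖curl (u t) x‖ ^ 2 := ⟨_, rfl⟩
  obtain ⟨Pr, hPr_def⟩ : ∃ Pr : ℝ → ℝ,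
      Pr = fun t => ∫ x, frobeniusNormSq (fderiv ℝ (curl (u t)) x) := ⟨_, rfl⟩
  obtain ⟨Sr, hSr_def⟩ : ∃ Sr : ℝ → ℝ,
      Sr = fun t => ∫ x, ⟪curl (u t) x, fderiv ℝ (u t) x (curl (u t) x)⟫ := ⟨_, rfl⟩
  have hZ : ∀ t ∈ Ioo 0 T, ∫⁻ x, ‖curl (u t) x‖ₑ ^ 2 = ENNReal.ofReal (Zr t) ∧ 0 ≤ Zr t ∧
      0 ≤ Pr t ∧ Pr t = ∫ x, frobeniusNormSq (fderiv ℝ (curl (u t)) x) ∧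
      Sr t = ∫ x, ⟪curl (u t) x, fderiv ℝ (u t) x (curl (u t) x)⟫ ∧
      HasDerivAt Zr (2 * Sr t - 2 * ν * Pr t) t := by
    intro t ht
    have htI : t ∈ Ico 0 T := ⟨ht.1.le, ht.2⟩
    have hv2 : ContDiff ℝ 2 (u t) := (hsol.contDiff_velocity htI).of_le (by norm_cast)
    have h1 : ∫⁻ x, ‖iteratedFDeriv ℝ 1 (u t) x‖ₑ ^ 2 < ⊤ := by
      have hT' : (t + T) / 2 < T := by linarith [ht.2]
      obtain ⟨C, hC⟩ := hLS.sobolev _ hT' 1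
      exact (hC t ⟨ht.1.le, by linarith [ht.2]⟩).trans_lt ENNReal.coe_lt_top
    refine ⟨?_, ?_, ?_, ?_, ?_, ?_⟩
    · rw [hZr_def]; exact lintegral_enorm_curl_sq_eq_ofReal_integral hv2 h1
    · rw [hZr_def]; exact integral_nonneg fun x => sq_nonneg _
    · rw [hPr_def]; exact integral_nonneg fun x => frobeniusNormSq_nonneg _
    · rw [hPr_def]
    · rw [hSr_def]
    · have hD := (LucardoOlivaes2026.hasDerivAt_half_ensq hν hLS ht).const_mul 2
      have hfun : (fun s => 2 * ((1 / 2 : ℝ) * Literature.Claims.NS.LucardoOlivaes2026.ensq u s)) =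
          Zr := by
        funext s
        simp only [hZr_def, Literature.Claims.NS.LucardoOlivaes2026.ensq]
        ring
      rw [hfun] at hD
      refine hD.congr_deriv ?_
      simp only [hSr_def, hPr_def, Literature.Claims.NS.LucardoOlivaes2026.stretchI]
      ring
  -- the constants
  obtain ⟨V₁, hV₁_def⟩ : ∃ V₁ : ℝ, V₁ = (volume (ball (0 : EuclideanSpace ℝ (Fin 3)) 1)).toReal :=
    ⟨_, rfl⟩
  have hV₁ : 0 ≤ V₁ := by rw [hV₁_def]; exact ENNReal.toReal_nonneg
  obtain ⟨lam, hlam_def⟩ : ∃ lam : ℝ, lam = 4 * C' * N / Real.sqrt ν := ⟨_, rfl⟩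
  have hlam : 0 ≤ lam := by rw [hlam_def]; positivity
  have hlam2 : ν * lam ^ 2 = 16 * C' ^ 2 * N ^ 2 := by
    have hsν : Real.sqrt ν ^ 2 = ν := Real.sq_sqrt hν.le
    have hsν0 : Real.sqrt ν ≠ 0 := (Real.sqrt_pos.2 hν).ne'
    rw [hlam_def, div_pow, hsν]
    field_simp
    ring
  obtain ⟨a, ha_def⟩ : ∃ a : ℝ, a = 4 * C' ^ 2 / ν := ⟨_, rfl⟩
  have ha : 0 ≤ a := by rw [ha_def]; positivity
  obtain ⟨K, hK_def⟩ : ∃ K : ℝ,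
      K = 12 * (C' * (Real.sqrt T + N)) ^ 2 * Cg ^ 2 * (N * (lam ^ 3 * V₁)) / ν := ⟨_, rfl⟩
  have hK : 0 ≤ K := by rw [hK_def]; positivity
  -- Steps 3–4: the differential inequality on `(t₁, T)`
  have hineq : ∀ t ∈ Ioo t₁ T,
      2 * Sr t - 2 * ν * Pr t ≤ a * Zr t + Zr t / (4 * (T - t)) + K / Real.sqrt (T - t) ^ 3 := by
    intro t ht
    have ht0T : t ∈ Ioo 0 T := ⟨lt_of_le_of_lt ht₁0 ht.1, ht.2⟩
    have htI : t ∈ Ico 0 T := ⟨ht0T.1.le, ht.2⟩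
    have hTt : 0 < T - t := by linarith [ht.2]
    obtain ⟨hZeq, hZ0, hP0, hPeq, hSeq, -⟩ := hZ t ht0T
    -- `s = √(T−t)`
    obtain ⟨s, hs_def⟩ : ∃ s : ℝ, s = Real.sqrt (T - t) := ⟨_, rfl⟩
    have hs : 0 < s := by rw [hs_def]; exact Real.sqrt_pos.2 hTt
    have hs2 : s ^ 2 = T - t := by rw [hs_def]; exact Real.sq_sqrt hTt.le
    have hsT' : s ≤ Real.sqrt T := by
      rw [hs_def]; exact Real.sqrt_le_sqrt (by linarith [ht0T.1])
    rw [← hs_def]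
    -- the slice and its integrability (BKM class on `[0, (t+T)/2]`)
    have hv : ContDiff ℝ ∞ (u t) := hsol.contDiff_velocity htI
    have hv2 : ContDiff ℝ 2 (u t) := hv.of_le (by norm_cast)
    have hdiv : VectorCalculus.IsDivFree (u t) := hsol.divFree t htI
    have hT' : (t + T) / 2 < T := by linarith [ht.2]
    have hT'0 : 0 < (t + T) / 2 := by linarith [ht0T.1]
    have hsol' : IsClassicalNSSolutionOn (Icc 0 ((t + T) / 2)) ν 0 u p :=
      hsol.mono (Icc_subset_Ico_right hT') (uniqueDiffOn_Icc hT'0)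
    obtain ⟨iZ, iA, iJ⟩ := DepletionLadder.slice_integrability hsol' (hLS.sobolev _ hT')
      (t := t) ⟨ht0T.1.le, by linarith [ht.2]⟩
    -- `Zr t = ∫ ‖curl u(t)‖²`
    have hZr : Zr t = ∫ x, ‖curl (u t) x‖ ^ 2 := by rw [hZr_def]
    -- the slice estimate
    have henvt : ∀ x, ‖u t x‖ ≤ C' + ∑ a ∈ σ, C' / (‖x - a‖ + s) := by
      intro x; rw [hs_def]; exact henv t htI x
    have hGt : ∀ x, ‖fderiv ℝ (u t) x‖ ≤ Cg / (T - t) := hgrad t ht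
    have hCg0 : 0 ≤ Cg / (T - t) := (norm_nonneg _).trans (hGt 0)
    obtain ⟨y, hy_def⟩ : ∃ y : ℝ, y = N / ((lam + 1) * s) := ⟨_, rfl⟩
    have hy0 : 0 ≤ y := by rw [hy_def]; positivity
    obtain ⟨R, hR_def⟩ : ∃ R : ℝ, R = N * ((lam * s) ^ 3 * V₁) := ⟨_, rfl⟩
    have hR0 : 0 ≤ R := by rw [hR_def]; positivity
    obtain ⟨A₁, hA₁_def⟩ : ∃ A₁ : ℝ, A₁ = C' * (1 + y) * Real.sqrt (Zr t) := ⟨_, rfl⟩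
    obtain ⟨A₂, hA₂_def⟩ : ∃ A₂ : ℝ,
        A₂ = C' * (1 + N / s) * (Real.sqrt 6 * (Cg / (T - t))) * Real.sqrt R := ⟨_, rfl⟩
    have hA₁0 : 0 ≤ A₁ := by rw [hA₁_def]; positivity
    have hA₂0 : 0 ≤ A₂ := by rw [hA₂_def]; positivity
    have hslice : |Sr t| ≤ (A₁ + A₂) * Real.sqrt (∫ x, ‖curl (curl (u t)) x‖ ^ 2) := by
      rw [hSeq, hA₁_def, hA₂_def, hy_def, hR_def, hZr, hN_def, hV₁_def]
      exact slice_stretching_bound hv2 hdiv hC' hs hlam henvt hGt iZ iA iJ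
    -- `‖curl ω‖₂² ≤ 2 P`
    have hW : ∫ x, ‖curl (curl (u t)) x‖ ^ 2 ≤ 2 * Pr t := by
      rw [hPeq, ← integral_const_mul]
      exact integral_mono_of_nonneg (Eventually.of_forall fun x => sq_nonneg _) (iA.const_mul 2)
        (Eventually.of_forall fun x => norm_curl_sq_le_two_mul_frobeniusNormSq (curl (u t)) x)
    -- Young
    have hY := young_budget hν hA₁0 hA₂0 hP0 hslice hW
    -- `2A₁²/ν ≤ a Z + Z/(4(T−t))`
    have e1 : A₁ ^ 2 = C' ^ 2 * (1 + y) ^ 2 * Zr t := by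
      rw [hA₁_def, mul_pow, mul_pow, Real.sq_sqrt hZ0]
    have hkey : 4 * C' ^ 2 / ν * y ^ 2 ≤ 1 / (4 * (T - t)) := by
      have hν0 : ν ≠ 0 := hν.ne'
      have hl1 : lam + 1 ≠ 0 := by positivity
      have hTt0 : T - t ≠ 0 := hTt.ne'
      have e : 4 * C' ^ 2 / ν * y ^ 2 =
          (16 * C' ^ 2 * N ^ 2) / (ν * (lam + 1) ^ 2) * (1 / (4 * (T - t))) := by
        rw [hy_def, div_pow, mul_pow, hs2]
        field_simp
        ring
      rw [e]
      refine mul_le_of_le_one_left (by positivity) ?_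
      rw [div_le_one (by positivity), ← hlam2]
      exact mul_le_mul_of_nonneg_left (pow_le_pow_left₀ hlam (by linarith only) 2) hν.le
    have h1 : 2 * A₁ ^ 2 / ν ≤ a * Zr t + Zr t / (4 * (T - t)) := by
      have h1y : (1 + y) ^ 2 ≤ 2 + 2 * y ^ 2 := by nlinarith only [sq_nonneg (1 - y)]
      calc 2 * A₁ ^ 2 / ν = 2 * C' ^ 2 / ν * (1 + y) ^ 2 * Zr t := by rw [e1]; ring
        _ ≤ 2 * C' ^ 2 / ν * (2 + 2 * y ^ 2) * Zr t := by gcongr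
        _ = a * Zr t + (4 * C' ^ 2 / ν * y ^ 2) * Zr t := by rw [ha_def]; ring
        _ ≤ a * Zr t + 1 / (4 * (T - t)) * Zr t := by gcongr
        _ = a * Zr t + Zr t / (4 * (T - t)) := by ring
    -- `2A₂²/ν ≤ K/s³`
    have h2 : 2 * A₂ ^ 2 / ν ≤ K / s ^ 3 := by
      -- `1 + N/s ≤ (√T + N)/s`
      have hB : C' * (1 + N / s) ≤ C' * (Real.sqrt T + N) / s := by
        rw [mul_div_assoc]
        refine mul_le_mul_of_nonneg_left ?_ hC'
        rw [le_div_iff₀ hs]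
        have : (1 + N / s) * s = s + N := by field_simp
        rw [this]
        linarith only [hsT']
      obtain ⟨A₂', hA₂'_def⟩ : ∃ A₂' : ℝ,
          A₂' = C' * (Real.sqrt T + N) / s * (Real.sqrt 6 * (Cg / (T - t))) * Real.sqrt R :=
        ⟨_, rfl⟩
      have hA₂le : A₂ ≤ A₂' := by
        rw [hA₂_def, hA₂'_def]
        exact mul_le_mul_of_nonneg_right (mul_le_mul_of_nonneg_right hB (by positivity))
          (Real.sqrt_nonneg _)
      have hRs : Real.sqrt R ^ 2 = N * ((lam * s) ^ 3 * V₁) := by rw [Real.sq_sqrt hR0, hR_def]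
      have h6 : Real.sqrt 6 ^ 2 = 6 := Real.sq_sqrt (by norm_num)
      have hν0 : ν ≠ 0 := hν.ne'
      have hs0 : s ≠ 0 := hs.ne'
      have e2 : 2 * A₂' ^ 2 / ν = K / s ^ 3 := by
        rw [hA₂'_def, hK_def]
        simp only [mul_pow, div_pow, h6, hRs, ← hs2]
        field_simp
        ring
      calc 2 * A₂ ^ 2 / ν ≤ 2 * A₂' ^ 2 / ν := by gcongr
        _ = K / s ^ 3 := e2
    calc 2 * Sr t - 2 * ν * Pr t ≤ 2 * (A₁ ^ 2 + A₂ ^ 2) / ν := hY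
      _ = 2 * A₁ ^ 2 / ν + 2 * A₂ ^ 2 / ν := by ring
      _ ≤ (a * Zr t + Zr t / (4 * (T - t))) + K / s ^ 3 := add_le_add h1 h2
  -- Step 5: Gronwall near `T`
  have hder : ∀ t ∈ Ioo t₁ T, HasDerivAt Zr (2 * Sr t - 2 * ν * Pr t) t := fun t ht =>
    (hZ t ⟨lt_of_le_of_lt ht₁0 ht.1, ht.2⟩).2.2.2.2.2
  have hZ0' : ∀ t ∈ Ioo t₁ T, 0 ≤ Zr t := fun t ht => (hZ t ⟨lt_of_le_of_lt ht₁0 ht.1, ht.2⟩).2.1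
  obtain ⟨K₁, hK₁⟩ := gronwall_quarter (φ := Zr) (dφ := fun t => 2 * Sr t - 2 * ν * Pr t)
    ht₁T ha hK hZ0' hder hineq
  -- the initial interval `[0, t₂]`: bounded Sobolev norms
  obtain ⟨t₂, ht₂_def⟩ : ∃ t₂ : ℝ, t₂ = (t₁ + T) / 2 := ⟨_, rfl⟩
  have ht₂T : t₂ < T := by rw [ht₂_def]; linarith
  have ht₂0 : 0 < t₂ := by rw [ht₂_def]; linarith
  obtain ⟨C₁, hC₁⟩ := hLS.sobolev t₂ ht₂T 1
  have hinit : ∀ t ∈ Icc 0 t₂, ∫⁻ x, ‖curl (u t) x‖ₑ ^ 2 ≤ 6 * (C₁ : ℝ≥0∞) := fun t ht =>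
    calc ∫⁻ x, ‖curl (u t) x‖ₑ ^ 2 ≤ ∫⁻ x, 6 * ‖iteratedFDeriv ℝ 1 (u t) x‖ₑ ^ 2 :=
          lintegral_mono fun x => RungReynoldsOne.enorm_curl_sq_le_six_mul (u t) x
      _ = 6 * ∫⁻ x, ‖iteratedFDeriv ℝ 1 (u t) x‖ₑ ^ 2 := lintegral_const_mul' _ _ (by norm_num)
      _ ≤ 6 * C₁ := by gcongr; exact hC₁ t ht
  obtain ⟨K₂, hK₂_def⟩ : ∃ K₂ : ℝ, K₂ = 6 * (C₁ : ℝ) * Real.sqrt T := ⟨_, rfl⟩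
  refine ⟨max K₁ K₂, fun t ht => ?_⟩
  obtain ⟨hs, hsT'⟩ := hsT t ht
  by_cases htc : t₂ ≤ t
  · -- Gronwall regime
    have ht0T : t ∈ Ioo 0 T := ⟨lt_of_lt_of_le ht₂0 htc, ht.2⟩
    rw [(hZ t ht0T).1]
    exact ENNReal.ofReal_le_ofReal
      ((hK₁ t ⟨ht₂_def ▸ htc, ht.2⟩).trans (div_le_div_of_nonneg_right (le_max_left _ _) hs.le))
  · -- initial regime
    push Not at htc
    have h6 : (6 : ℝ≥0∞) * C₁ = ENNReal.ofReal (6 * (C₁ : ℝ)) := by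
      rw [ENNReal.ofReal_mul (by norm_num), ENNReal.ofReal_coe_nnreal, ENNReal.ofReal_ofNat]
    calc ∫⁻ x, ‖curl (u t) x‖ₑ ^ 2 ≤ 6 * (C₁ : ℝ≥0∞) := hinit t ⟨ht.1, htc.le⟩
      _ = ENNReal.ofReal (6 * (C₁ : ℝ)) := h6
      _ ≤ ENNReal.ofReal (max K₁ K₂ / Real.sqrt (T - t)) := by
          refine ENNReal.ofReal_le_ofReal ?_
          rw [le_div_iff₀ hs]
          have hC₁0 : 0 ≤ (C₁ : ℝ) := C₁.2
          calc 6 * (C₁ : ℝ) * Real.sqrt (T - t) ≤ 6 * (C₁ : ℝ) * Real.sqrt T := by gcongr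
            _ = K₂ := by rw [hK₂_def]
            _ ≤ max K₁ K₂ := le_max_right _ _

end EnvelopeQuarterLaw

/-- **Item stmt-NavierStokesRegularity-23844** (`TypeIQuarterGate.EnvelopeQuarterLaw`; = registered stub
`stub_envelopeQuarter` of the line `scar-envelope` of the crux `QuarterLawTypeI`, stmt-23726): under the
scar envelope `‖u(t,x)‖ ≤ C' + Σ_{a∈σ} C'/(‖x−a‖ + √(T−t))` a maximal smooth Leray–Hopf
rapidly-decaying-datum solution obeys Leray's quarter rate `∫‖curl u(t)‖² ≤ K/√(T−t)` on `[0,T)`.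
Bookkeeping along a hypothetical blow-up solution; nothing about Navier–Stokes regularity or blow-up is
asserted, and the cruxes of the route are not touched.
[cite: KochNadirashviliSereginSverak2009, §4 Prop. 4.1 (4.6) (arXiv:0709.3599v1 p. 8)] -/
theorem typeIQuarterGate_envelopeQuarterLaw_proof :
    Summit.NavierStokesRegularity.NavierStokesRegularity.Theses.TypeIQuarterGate.EnvelopeQuarterLaw := by
  unfold Summit.NavierStokesRegularity.NavierStokesRegularity.Theses.TypeIQuarterGate.EnvelopeQuarterLaw
  exact EnvelopeQuarterLaw.main

end Summit.NavierStokesRegularity.NavierStokesRegularity.Theorems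

end
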